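import Mathlib
import Literature.NumberTheory.Transcendental.KZHyperbolicLadder
import Summits.KontsevichZagierPeriods.KontsevichZagierPeriods.Theorems.HyperbolicBlochOffTetraSectorKernelStubInversionMove

/-!
# Stub `isGeodesicPolytope_image_unitInversion`
# (crux `OffTetraSectorKernel`, line `odd-hyperbolic-ladder`)

Rung `n` of Goncharov's hyperbolic scissors ladder is the upper half-space model
`{p : Fin (n + 1) → ℝ | 0 < p (last n)}` of `ℍⁿ⁺¹` with volume density `t^{-(n+1)}`; its objects are
the finite-volume `ℚ̄`-geodesic polytopes `KZ.IsGeodesicPolytope n P` (finite intersections of the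
half-space with open geodesic half-spaces bounded by vertical hyperplanes `Σ aₗ pₗ = c` or hemispheres
`Σ (pₗ − aₗ)² = c` centred on the boundary, real-algebraic data). We prove that the UNIT INVERSION
`J p = p / ‖p‖²` (`KZ.unitInversion n`), one of the two generating `ℚ̄`-Möbius moves, maps polytopes
to polytopes. Writing `s = ‖q‖²`, `X = ⟨a, q⟩`, `A = ‖a‖²`, for `q` in the half-space:

* flat face, `c = 0`:  `⟨a, Jq⟩ = X / s` — the same vertical hyperplane;
* flat face, `c ≠ 0`:  `⟨a, Jq⟩ − c = (X − c s)/s` and `‖q − a/(2c)‖² − A/(4c²) = (c s − X)/c` — a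
  hemisphere centred at `a/(2c)` (sign flipped iff `0 < c`);
* round face through the origin (`A = c`): `‖Jq − a‖² − c = (1 − 2X)/s` — the vertical hyperplane
  `⟨a, q⟩ = 1/2` (sign flipped);
* round face, `D = A − c ≠ 0`: `‖Jq − a‖² − c = (1 − 2X + D s)/s` and
  `‖q − a/D‖² − c/D² = (D s − 2X + 1)/D` — a hemisphere centred at `a/D` (sign flipped iff `D < 0`).

All new data are rational expressions in the old, hence algebraic, and the new centres/normals still
have last coordinate `0`. Since `J` is an involution of the half-space, `J '' P = {q | 0 < q last ∧ J q ∈ P}`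
is cut out by the transformed faces; and `t^{-(n+1)}` is integrable on `J '' P` by the change-of-variables
criterion with the Jacobian identity `|det DJ(p)| · ((Jp) last)^{-(n+1)} = t^{-(n+1)}` of the landed
inversion move (`inversionN_hasFDerivAt_det`).

References: R. Benedetti, C. Petronio, *Lectures on Hyperbolic Geometry* (1992), A.3.5;
A. B. Goncharov, *Volumes of hyperbolic manifolds and mixed Tate motives* (1999), §1.1.
-/

noncomputable section

open Set MeasureTheory
open Literature.NumberTheory.Transcendental

namespace Summit.KontsevichZagierPeriods.HyperbolicBloch.OffTetraSectorKernel

variable {n : ℕ}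

/-! ### Algebra of the transformed faces -/

/-- `Σₗ aₗ (qₗ / s) = (Σₗ aₗ qₗ) / s`. [folklore] -/
theorem invFace_sum_mul_div (a q : Fin (n + 1) → ℝ) (s : ℝ) :
    ∑ l, a l * (q l / s) = (∑ l, a l * q l) / s := by
  rw [Finset.sum_div]
  exact Finset.sum_congr rfl fun l _ => (mul_div_assoc (a l) (q l) s).symm

/-- `Σₗ (qₗ − aₗ/d)² = Σ qₗ² − (2/d) Σ aₗ qₗ + (Σ aₗ²)/d²`. [folklore] -/
theorem invFace_sum_sq_sub_div (a q : Fin (n + 1) → ℝ) (d : ℝ) :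
    ∑ l, (q l - a l / d) ^ 2 = (∑ m, q m ^ 2) - 2 / d * ∑ l, a l * q l + (∑ l, a l ^ 2) / d ^ 2 := by
  rw [Finset.mul_sum, Finset.sum_div, ← Finset.sum_sub_distrib, ← Finset.sum_add_distrib]
  exact Finset.sum_congr rfl fun l _ => by ring

/-- `Σₗ (qₗ/s − aₗ)² = (Σ qₗ²)/s² − (2/s) Σ aₗ qₗ + Σ aₗ²`. [folklore] -/
theorem invFace_sum_div_sub_sq (a q : Fin (n + 1) → ℝ) (s : ℝ) :
    ∑ l, (q l / s - a l) ^ 2 = (∑ m, q m ^ 2) / s ^ 2 - 2 / s * ∑ l, a l * q l + ∑ l, a l ^ 2 := by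
  rw [Finset.mul_sum, Finset.sum_div, ← Finset.sum_sub_distrib, ← Finset.sum_add_distrib]
  exact Finset.sum_congr rfl fun l _ => by ring

/-- Inversion of a vertical hyperplane THROUGH the origin (`c = 0`): the same hyperplane,
`0 < ε ⟨a, Jq⟩ ↔ 0 < ε ⟨a, q⟩`. [cite: BenedettiPetronio1992, A.3.5] -/
theorem invFace_flat_zero (a q : Fin (n + 1) → ℝ) (ε : ℝ) (hs : 0 < ∑ m, q m ^ 2) :
    0 < ε * ((∑ l, a l * (q l / ∑ m, q m ^ 2)) - 0) ↔ 0 < ε * ((∑ l, a l * q l) - 0) := by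
  rw [invFace_sum_mul_div, sub_zero, sub_zero, ← mul_div_assoc, div_pos_iff_of_pos_right hs]

/-- Inversion of a vertical hyperplane `⟨a, p⟩ = c` with `0 < c`: the hemisphere centred at `a/(2c)` of
squared radius `‖a‖²/(4c²)`, opposite sign. [cite: BenedettiPetronio1992, A.3.5] -/
theorem invFace_flat_pos (a q : Fin (n + 1) → ℝ) (c ε : ℝ) (hc : 0 < c) (hs : 0 < ∑ m, q m ^ 2) :
    0 < ε * ((∑ l, a l * (q l / ∑ m, q m ^ 2)) - c) ↔
      0 < -ε * ((∑ l, (q l - a l / (2 * c)) ^ 2) - (∑ l, a l ^ 2) / (4 * c ^ 2)) := by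
  have hs0 : (∑ m, q m ^ 2) ≠ 0 := hs.ne'
  have hc0 : c ≠ 0 := hc.ne'
  have h1 : ε * ((∑ l, a l * (q l / ∑ m, q m ^ 2)) - c) =
      ε * ((∑ l, a l * q l) - c * ∑ m, q m ^ 2) / ∑ m, q m ^ 2 := by
    rw [invFace_sum_mul_div]
    field_simp
  have h2 : -ε * ((∑ l, (q l - a l / (2 * c)) ^ 2) - (∑ l, a l ^ 2) / (4 * c ^ 2)) =
      ε * ((∑ l, a l * q l) - c * ∑ m, q m ^ 2) / c := by
    rw [invFace_sum_sq_sub_div]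
    field_simp
    ring
  rw [h1, h2, div_pos_iff_of_pos_right hs, div_pos_iff_of_pos_right hc]

/-- Inversion of a vertical hyperplane `⟨a, p⟩ = c` with `c < 0`: the hemisphere centred at `a/(2c)` of
squared radius `‖a‖²/(4c²)`, same sign. [cite: BenedettiPetronio1992, A.3.5] -/
theorem invFace_flat_neg (a q : Fin (n + 1) → ℝ) (c ε : ℝ) (hc : c < 0) (hs : 0 < ∑ m, q m ^ 2) :
    0 < ε * ((∑ l, a l * (q l / ∑ m, q m ^ 2)) - c) ↔
      0 < ε * ((∑ l, (q l - a l / (2 * c)) ^ 2) - (∑ l, a l ^ 2) / (4 * c ^ 2)) := by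
  have hs0 : (∑ m, q m ^ 2) ≠ 0 := hs.ne'
  have hc0 : c ≠ 0 := hc.ne
  have h1 : ε * ((∑ l, a l * (q l / ∑ m, q m ^ 2)) - c) =
      ε * ((∑ l, a l * q l) - c * ∑ m, q m ^ 2) / ∑ m, q m ^ 2 := by
    rw [invFace_sum_mul_div]
    field_simp
  have h2 : ε * ((∑ l, (q l - a l / (2 * c)) ^ 2) - (∑ l, a l ^ 2) / (4 * c ^ 2)) =
      ε * ((∑ l, a l * q l) - c * ∑ m, q m ^ 2) / (-c) := by
    rw [invFace_sum_sq_sub_div]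
    field_simp
    ring
  rw [h1, h2, div_pos_iff_of_pos_right hs, div_pos_iff_of_pos_right (neg_pos.mpr hc)]

/-- Inversion of a hemisphere `‖p − a‖² = c` THROUGH the origin (`‖a‖² = c`): the vertical hyperplane
`⟨a, q⟩ = 1/2`, opposite sign. [cite: BenedettiPetronio1992, A.3.5] -/
theorem invFace_round_origin (a q : Fin (n + 1) → ℝ) (c ε : ℝ) (hA : ∑ l, a l ^ 2 - c = 0)
    (hs : 0 < ∑ m, q m ^ 2) :
    0 < ε * ((∑ l, (q l / (∑ m, q m ^ 2) - a l) ^ 2) - c) ↔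
      0 < -ε * ((∑ l, a l * q l) - 1 / 2) := by
  have hs0 : (∑ m, q m ^ 2) ≠ 0 := hs.ne'
  have hc : c = ∑ l, a l ^ 2 := (sub_eq_zero.mp hA).symm
  have h1 : ε * ((∑ l, (q l / (∑ m, q m ^ 2) - a l) ^ 2) - c) =
      ε * (1 - 2 * ∑ l, a l * q l) / ∑ m, q m ^ 2 := by
    rw [invFace_sum_div_sub_sq, hc]
    field_simp
    ring
  have h2 : -ε * ((∑ l, a l * q l) - 1 / 2) = ε * (1 - 2 * ∑ l, a l * q l) / 2 := by ring
  rw [h1, h2, div_pos_iff_of_pos_right hs, div_pos_iff_of_pos_right two_pos]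

/-- Inversion of a hemisphere `‖p − a‖² = c` with `D = ‖a‖² − c > 0`: the hemisphere centred at `a/D`
of squared radius `c/D²`, same sign. [cite: BenedettiPetronio1992, A.3.5] -/
theorem invFace_round_pos (a q : Fin (n + 1) → ℝ) (c ε D : ℝ) (hD : ∑ l, a l ^ 2 - c = D)
    (hDpos : 0 < D) (hs : 0 < ∑ m, q m ^ 2) :
    0 < ε * ((∑ l, (q l / (∑ m, q m ^ 2) - a l) ^ 2) - c) ↔
      0 < ε * ((∑ l, (q l - a l / D) ^ 2) - c / D ^ 2) := by
  have hs0 : (∑ m, q m ^ 2) ≠ 0 := hs.ne'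
  have hD0 : D ≠ 0 := hDpos.ne'
  have hA : ∑ l, a l ^ 2 = D + c := by rw [← hD]; ring
  have h1 : ε * ((∑ l, (q l / (∑ m, q m ^ 2) - a l) ^ 2) - c) =
      ε * (1 - 2 * (∑ l, a l * q l) + D * ∑ m, q m ^ 2) / ∑ m, q m ^ 2 := by
    rw [invFace_sum_div_sub_sq, hA]
    field_simp
    ring
  have h2 : ε * ((∑ l, (q l - a l / D) ^ 2) - c / D ^ 2) =
      ε * (1 - 2 * (∑ l, a l * q l) + D * ∑ m, q m ^ 2) / D := by
    rw [invFace_sum_sq_sub_div, hA]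
    field_simp
    ring
  rw [h1, h2, div_pos_iff_of_pos_right hs, div_pos_iff_of_pos_right hDpos]

/-- Inversion of a hemisphere `‖p − a‖² = c` with `D = ‖a‖² − c < 0`: the hemisphere centred at `a/D`
of squared radius `c/D²`, opposite sign. [cite: BenedettiPetronio1992, A.3.5] -/
theorem invFace_round_neg (a q : Fin (n + 1) → ℝ) (c ε D : ℝ) (hD : ∑ l, a l ^ 2 - c = D)
    (hDneg : D < 0) (hs : 0 < ∑ m, q m ^ 2) :
    0 < ε * ((∑ l, (q l / (∑ m, q m ^ 2) - a l) ^ 2) - c) ↔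
      0 < -ε * ((∑ l, (q l - a l / D) ^ 2) - c / D ^ 2) := by
  have hs0 : (∑ m, q m ^ 2) ≠ 0 := hs.ne'
  have hD0 : D ≠ 0 := hDneg.ne
  have hA : ∑ l, a l ^ 2 = D + c := by rw [← hD]; ring
  have h1 : ε * ((∑ l, (q l / (∑ m, q m ^ 2) - a l) ^ 2) - c) =
      ε * (1 - 2 * (∑ l, a l * q l) + D * ∑ m, q m ^ 2) / ∑ m, q m ^ 2 := by
    rw [invFace_sum_div_sub_sq, hA]
    field_simp
    ring
  have h2 : -ε * ((∑ l, (q l - a l / D) ^ 2) - c / D ^ 2) =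
      ε * (1 - 2 * (∑ l, a l * q l) + D * ∑ m, q m ^ 2) / (-D) := by
    rw [invFace_sum_sq_sub_div, hA]
    field_simp
    ring
  rw [h1, h2, div_pos_iff_of_pos_right hs, div_pos_iff_of_pos_right (neg_pos.mpr hDneg)]

/-! ### One face at a time -/

/-- **Inversion of one geodesic face.** For a face datum (`b`, `a`, `c`, `ε`) of a `ℚ̄`-geodesic polytope
(vertical hyperplane `Σ aₗ pₗ = c` if `b`, hemisphere `Σ (pₗ − aₗ)² = c` otherwise; `a (last) = 0`, `ε = ±1`,
algebraic data) there is a face datum (`b'`, `a'`, `c'`, `ε'`) of the same kind such that, on the punctured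
space `‖q‖ ≠ 0`, `J q` lies on the `ε`-side of the old face iff `q` lies on the `ε'`-side of the new one
(`J` the unit inversion): inversion maps vertical hyperplanes and boundary-centred hemispheres to vertical
hyperplanes and boundary-centred hemispheres with rational new data. [cite: BenedettiPetronio1992, A.3.5] -/
theorem invFace_exists (b : Bool) (a : Fin (n + 1) → ℝ) (c ε : ℝ) (ha : ∀ l, IsAlgebraic ℚ (a l))
    (hc : IsAlgebraic ℚ c) (hε : ε = 1 ∨ ε = -1) (ha0 : a (Fin.last n) = 0) :
    ∃ (b' : Bool) (a' : Fin (n + 1) → ℝ) (c' ε' : ℝ), (∀ l, IsAlgebraic ℚ (a' l)) ∧ IsAlgebraic ℚ c' ∧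
      (ε' = 1 ∨ ε' = -1) ∧ a' (Fin.last n) = 0 ∧
      ∀ q : Fin (n + 1) → ℝ, 0 < ∑ m, q m ^ 2 →
        ((0 < ε * (if b then (∑ l, a l * KZ.unitInversion n q l) - c
            else (∑ l, (KZ.unitInversion n q l - a l) ^ 2) - c)) ↔
          (0 < ε' * (if b' then (∑ l, a' l * q l) - c' else (∑ l, (q l - a' l) ^ 2) - c'))) := by
  have hnegε : -ε = 1 ∨ -ε = -1 := by rcases hε with h | h <;> subst h <;> norm_num
  -- a finite sum of (squares of) algebraic numbers is algebraic
  have hA : IsAlgebraic ℚ (∑ l, a l ^ 2) :=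
    Finset.sum_induction (fun l => a l ^ 2) (IsAlgebraic ℚ) (fun _ _ hx hy => hx.add hy)
      isAlgebraic_zero fun l _ => (ha l).pow 2
  have h2 : IsAlgebraic ℚ (2 : ℝ) := isAlgebraic_nat 2
  have h4 : IsAlgebraic ℚ (4 : ℝ) := isAlgebraic_nat 4
  cases b
  · -- a hemisphere `Σ (pₗ − aₗ)² = c`; `D = ‖a‖² − c`
    obtain ⟨D, hD⟩ : ∃ D, ∑ l, a l ^ 2 - c = D := ⟨_, rfl⟩
    have hDalg : IsAlgebraic ℚ D := hD ▸ hA.sub hc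
    rcases lt_trichotomy D 0 with hneg | hzero | hpos
    · refine ⟨false, fun l => a l / D, c / D ^ 2, -ε, fun l => ?_, ?_, hnegε, ?_, fun q hs => ?_⟩
      · show IsAlgebraic ℚ (a l / D)
        rw [div_eq_mul_inv]; exact (ha l).mul hDalg.inv
      · rw [div_eq_mul_inv]; exact hc.mul (hDalg.pow 2).inv
      · show a (Fin.last n) / D = 0
        rw [ha0, zero_div]
      · exact invFace_round_neg a q c ε D hD hneg hs
    · refine ⟨true, a, 1 / 2, -ε, ha, ?_, hnegε, ha0, fun q hs => ?_⟩
      · rw [one_div]; exact h2.inv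
      · exact invFace_round_origin a q c ε (hD.trans hzero) hs
    · refine ⟨false, fun l => a l / D, c / D ^ 2, ε, fun l => ?_, ?_, hε, ?_, fun q hs => ?_⟩
      · show IsAlgebraic ℚ (a l / D)
        rw [div_eq_mul_inv]; exact (ha l).mul hDalg.inv
      · rw [div_eq_mul_inv]; exact hc.mul (hDalg.pow 2).inv
      · show a (Fin.last n) / D = 0
        rw [ha0, zero_div]
      · exact invFace_round_pos a q c ε D hD hpos hs
  · -- a vertical hyperplane `Σ aₗ pₗ = c`
    rcases lt_trichotomy c 0 with hneg | hzero | hpos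
    · refine ⟨false, fun l => a l / (2 * c), (∑ l, a l ^ 2) / (4 * c ^ 2), ε, fun l => ?_, ?_, hε, ?_,
        fun q hs => ?_⟩
      · show IsAlgebraic ℚ (a l / (2 * c))
        rw [div_eq_mul_inv]; exact (ha l).mul (h2.mul hc).inv
      · rw [div_eq_mul_inv]; exact hA.mul (h4.mul (hc.pow 2)).inv
      · show a (Fin.last n) / (2 * c) = 0
        rw [ha0, zero_div]
      · exact invFace_flat_neg a q c ε hneg hs
    · subst hzero
      exact ⟨true, a, 0, ε, ha, isAlgebraic_zero, hε, ha0, fun q hs => invFace_flat_zero a q ε hs⟩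
    · refine ⟨false, fun l => a l / (2 * c), (∑ l, a l ^ 2) / (4 * c ^ 2), -ε, fun l => ?_, ?_, hnegε, ?_,
        fun q hs => ?_⟩
      · show IsAlgebraic ℚ (a l / (2 * c))
        rw [div_eq_mul_inv]; exact (ha l).mul (h2.mul hc).inv
      · rw [div_eq_mul_inv]; exact hA.mul (h4.mul (hc.pow 2)).inv
      · show a (Fin.last n) / (2 * c) = 0
        rw [ha0, zero_div]
      · exact invFace_flat_pos a q c ε hpos hs

/-! ### The image of a polytope -/

/-- The unit inversion is an involution off the origin. [cite: BenedettiPetronio1992, A.3.5] -/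
theorem unitInversion_unitInversion {p : Fin (n + 1) → ℝ} (hp : ∑ m, p m ^ 2 ≠ 0) :
    KZ.unitInversion n (KZ.unitInversion n p) = p :=
  inversionN_inversionN hp

/-- For `P` inside the open upper half-space, `J '' P = {q | 0 < q (last) ∧ J q ∈ P}` (`J` is an
involution of the half-space). [folklore] -/
theorem image_unitInversion_eq {P : Set (Fin (n + 1) → ℝ)} (hP : P ⊆ {p | 0 < p (Fin.last n)}) :
    KZ.unitInversion n '' P = {q | 0 < q (Fin.last n) ∧ KZ.unitInversion n q ∈ P} := by
  ext q
  constructor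
  · rintro ⟨p, hp, rfl⟩
    have hpl : 0 < p (Fin.last n) := hP hp
    have hs : 0 < ∑ m, p m ^ 2 := inversionN_normSq_pos hpl
    exact ⟨div_pos hpl hs, by rwa [unitInversion_unitInversion hs.ne']⟩
  · rintro ⟨hq, hJq⟩
    exact ⟨KZ.unitInversion n q, hJq, unitInversion_unitInversion (inversionN_normSq_pos hq).ne'⟩

/-- A set cut out of the half-space by finitely many strict polynomial inequalities (the shape of
`KZ.IsGeodesicPolytope`) is open, hence measurable. [folklore] -/
theorem measurableSet_faces (k : ℕ) (flat : Fin k → Bool) (a : Fin k → Fin (n + 1) → ℝ)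
    (c ε : Fin k → ℝ) :
    MeasurableSet {p : Fin (n + 1) → ℝ | 0 < p (Fin.last n) ∧ ∀ i, 0 < ε i *
      (if flat i then (∑ l, a i l * p l) - c i else (∑ l, (p l - a i l) ^ 2) - c i)} := by
  simp only [Set.setOf_and, Set.setOf_forall]
  refine (measurableSet_lt measurable_const (measurable_pi_apply _)).inter
    (MeasurableSet.iInter fun i => (isOpen_lt continuous_const ?_).measurableSet)
  exact continuous_const.mul (Continuous.if_const _ (by fun_prop) (by fun_prop))

/-- **The unit inversion maps `ℚ̄`-geodesic polytopes to `ℚ̄`-geodesic polytopes** (stub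
`isGeodesicPolytope_image_unitInversion` of line `odd-hyperbolic-ladder`). The inversion `J p = p/‖p‖²`
of the upper half-space `ℝⁿ × ℝ₊` maps each vertical hyperplane / boundary-centred hemisphere with
real-algebraic data to a vertical hyperplane / boundary-centred hemisphere with real-algebraic data
(four cases: flat through the origin or not, round through the origin or not), so `J '' P` is again cut
out of the half-space by finitely many `ℚ̄`-geodesic faces (`J` is an involution); and its hyperbolic
volume is finite by the change of variables `p = J q`, `|det DJ| · ((Jp) last)^{-(n+1)} = t^{-(n+1)}`.
[cite: BenedettiPetronio1992, A.3.5] -/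
theorem isGeodesicPolytope_image_unitInversion : ∀ (n : ℕ) (P : Set (Fin (n + 1) → ℝ)), Literature.NumberTheory.Transcendental.KZ.IsGeodesicPolytope n P → Literature.NumberTheory.Transcendental.KZ.IsGeodesicPolytope n (Literature.NumberTheory.Transcendental.KZ.unitInversion n '' P) := by
  intro n P hP
  obtain ⟨k, flat, a, c, ε, ha, hc, hε, ha0, hPeq, hint⟩ := hP
  choose b' a' c' ε' ha' hc' hε' ha0' hiff using
    fun i => invFace_exists (flat i) (a i) (c i) (ε i) (ha i) (hc i) (hε i) (ha0 i)
  have hPsub : P ⊆ {p | 0 < p (Fin.last n)} := by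
    rw [hPeq]
    exact fun p hp => hp.1
  refine ⟨k, b', a', c', ε', ha', hc', hε', ha0', ?_, ?_⟩
  · -- the image is cut out by the transformed faces
    rw [image_unitInversion_eq hPsub, hPeq]
    ext q
    simp only [Set.mem_setOf_eq]
    refine and_congr_right fun hq => ?_
    have hs : 0 < ∑ m, q m ^ 2 := inversionN_normSq_pos hq
    exact ⟨fun h i => (hiff i q hs).1 (h.2 i), fun h => ⟨div_pos hq hs, fun i => (hiff i q hs).2 (h i)⟩⟩
  · -- finite volume: change of variables `p = J q`
    have hmeas : MeasurableSet P := hPeq ▸ measurableSet_faces k flat a c ε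
    have hex : ∀ x : Fin (n + 1) → ℝ, ∃ L : (Fin (n + 1) → ℝ) →L[ℝ] (Fin (n + 1) → ℝ),
        ∑ m, x m ^ 2 ≠ 0 → HasFDerivAt (KZ.unitInversion n) L x ∧
          L.det = -((∑ m, x m ^ 2) ^ (n + 1))⁻¹ := by
      intro x
      by_cases hx : ∑ m, x m ^ 2 = 0
      · exact ⟨0, fun h => (h hx).elim⟩
      · obtain ⟨L, hL, hdet⟩ := inversionN_hasFDerivAt_det hx
        exact ⟨L, fun _ => ⟨hL, hdet⟩⟩
    choose J' hJ' using hex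
    have hinj : InjOn (KZ.unitInversion n) P := inversionN_injOn hPsub
    rw [integrableOn_image_iff_integrableOn_abs_det_fderiv_smul volume hmeas
      (fun x hx => ((hJ' x (inversionN_normSq_pos (hPsub hx)).ne').1).hasFDerivWithinAt) hinj]
    refine hint.congr_fun (fun x hx => ?_) hmeas
    have hs : 0 < ∑ m, x m ^ 2 := inversionN_normSq_pos (hPsub hx)
    have hpow : (∑ m, x m ^ 2) ^ (n + 1) ≠ 0 := pow_ne_zero _ hs.ne'
    rw [(hJ' x hs.ne').2, abs_neg, abs_of_pos (inv_pos.mpr (pow_pos hs _)), smul_eq_mul]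
    simp only [KZ.hypDensity, KZ.unitInversion]
    rw [div_pow, one_div_div, ← mul_div_assoc, inv_mul_cancel₀ hpow]

end Summit.KontsevichZagierPeriods.HyperbolicBloch.OffTetraSectorKernel

end
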